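import Summits.Ventures.CertifiedManyBodySolver.Certificates.HubbardSquare_transportClosure_Kit
import Literature.MathematicalPhysics.QuantumLattice.HubbardTTPrimeDiagonalUAnchors
import HarnessLib

/-!
# Ventures/CertifiedManyBodySolver — Certificates/HubbardSquare_transportClosure_KitDGU.lean
# (hubbard-fast-reuse-3 g2, cell hubbard-fast, D-0154 (A) CERTIFICATE REUSE, path family «t′/U DOUBLING ANCHORS»: the
# TRANSPORT-CLOSURE kit, part «t′-EDGE WITH U-CONTENT»; parts 1/2/3 = reuse-1's `…_Kit` / `…_KitLaws`, reuse-5's `…_KitT`)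

One-step OUTWARD transport law ALONG `t'` for the cell's kernel `e₀` words (surrogate-1 `_mlword_Icc` contract: coordinates
`θ = ![U/t, t'/t, n]`).  The `t'`-CHORD floor of `…_KitT` needs a floored column on BOTH sides of the target; beyond the
last floored column `t' = s₁` the pool so far paid the KINEMATIC edge price `(16/π²)·|θ1 − s₁|` (`cell_point_edge_floor`,
U- and n-blind).  The doubling-anchor law of the tree (`energyDensityTT'_ge_of_columnFloor_diagU`, box-p1/box-p3: for a
translation-invariant state the pure diagonal band `δT' + |δ|W·D` is two nearest-neighbour copies, so
`e(t, s, U, n) ≥ L(s₁, U − |s − s₁|·W, n) + |s − s₁|·ℓ` whenever `ℓ ≤ e(1, 0, W, n)`, `W ≥ 0`, [Israel 1979, Thm. I.3.4])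
replaces `16/π²` by `|ℓ_W(n)|` — the value of a `t' = 0` ALL-DENSITY floor sheet (registry n-tangent / half-filling-tangent
claim nodes) — at the cost of reading the column floor `|s − s₁|·W` LOWER in `U`.
* `tc_mlFloor_tEdgeDGU_below` — target strip `θ1 ≤ s₁` (hole side beyond the most negative floored column): from a BILINEAR
  column floor `A(U,n) ≤ e(t, s₁, U, n)` on `[p, q] × [n₁, n₂]` and a sheet `f₀ + f₁ m ≤ e(1, 0, W, m)` (`0 < m < 2`) the EXACT
  multilinear floor `A(θ0 − (s₁ − θ1)W, θ2) + (s₁ − θ1)(f₀ + f₁θ2) ≤ e(t, θ1, θ0, θ2)` on any cell whose displaced `U`-range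
  lies in `[p, q]`; consumers equate their 8 literal coefficients to this form by `ring`.
* `tc_mlFloor_tEdgeDGU_above` — the mirror statement for `θ1 ≥ s₁`.
HONEST FRAMING: bookkeeping adapters; they certify nothing by themselves; every consumer word inherits exactly the hypotheses of
the words/sheets it cites; no number of record; not a phase word; no summit statement is proved here; not a superconductivity verdict.
-/

namespace Summit.Ventures.CertifiedManyBodySolver.Certificates

open Literature.MathematicalPhysics.QuantumLattice
open Literature.MathematicalPhysics.QuantumLattice.ThermodynamicLimit
open Set

/-! ### One-step outward transport along `t'` with `U`-content (doubling anchor) -/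

/-- **`t'`-EDGE FLOOR WITH `U`-CONTENT, below the column** (`θ1 ≤ s₁`): a bilinear column floor
`α₀ + α₁U + α₂n + α₃Un ≤ e(t, s₁, U, n)` on `[p, q] × [n₁, n₂]` (`p ≥ 0`, `0 < n₁`, `n₂ < 2`) and a `t' = 0` all-density
sheet `f₀ + f₁m ≤ e(1, 0, W, m)` (`W ≥ 0`) give, on every cell `[Ua, Ub] × [sa, sb] × [n₁, n₂]` with `sb ≤ s₁`,
`p ≤ Ua − (s₁ − sa)W` and `Ub − (s₁ − sb)W ≤ q`, the floor
`A(θ0 − (s₁ − θ1)W, θ2) + (s₁ − θ1)(f₀ + f₁θ2) ≤ e(t, θ1, θ0, θ2)` — the doubling-anchor price `|f₀ + f₁n|` per unit `t'`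
instead of the kinematic `16/π²`. [cite: Israel1979, Thm. I.3.4] -/
theorem tc_mlFloor_tEdgeDGU_below (t : ℝ) {s₁ W p q Ua Ub sa sb n₁ n₂ α₀ α₁ α₂ α₃ f₀ f₁ : ℝ}
    (hp : 0 ≤ p) (hW : 0 ≤ W) (hsb : sb ≤ s₁) (hn₁ : 0 < n₁) (hn₂ : n₂ < 2)
    (hpa : p ≤ Ua - (s₁ - sa) * W) (hqb : Ub - (s₁ - sb) * W ≤ q)
    (hA : ∀ U n : ℝ, p ≤ U → U ≤ q → n₁ ≤ n → n ≤ n₂ →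
      α₀ + α₁ * U + α₂ * n + α₃ * U * n ≤ energyDensityTT' t s₁ U n)
    (hF : ∀ m : ℝ, 0 < m → m < 2 → f₀ + f₁ * m ≤ energyDensityTT' 1 0 W m) :
    ∀ θ ∈ Set.Icc (![Ua, sa, n₁] : Fin 3 → ℝ) ![Ub, sb, n₂],
      α₀ + α₁ * (θ 0 - (s₁ - θ 1) * W) + α₂ * θ 2 + α₃ * (θ 0 - (s₁ - θ 1) * W) * θ 2 +
          (s₁ - θ 1) * (f₀ + f₁ * θ 2) ≤ energyDensityTT' t (θ 1) (θ 0) (θ 2) := by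
  intro θ hθ
  obtain ⟨⟨k1, k2⟩, ⟨k3, k4⟩, ⟨k5, k6⟩⟩ := mem_Icc_vec3_iff.1 hθ
  have hn0 : 0 < θ 2 := lt_of_lt_of_le hn₁ k5
  have hn2 : θ 2 < 2 := lt_of_le_of_lt k6 hn₂
  have hδ : |θ 1 - s₁| = s₁ - θ 1 := by
    rw [abs_of_nonpos (by linarith)]; ring
  have hd0 : 0 ≤ s₁ - θ 1 := by linarith
  -- the displaced column point `U₁ = θ0 − (s₁ − θ1)·W` lies in `[p, q]`
  have hlo : p ≤ θ 0 - (s₁ - θ 1) * W := by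
    have h1 : (s₁ - θ 1) * W ≤ (s₁ - sa) * W := mul_le_mul_of_nonneg_right (by linarith) hW
    linarith
  have hhi : θ 0 - (s₁ - θ 1) * W ≤ q := by
    have h1 : (s₁ - sb) * W ≤ (s₁ - θ 1) * W := mul_le_mul_of_nonneg_right (by linarith) hW
    linarith
  have hA' := hA (θ 0 - (s₁ - θ 1) * W) (θ 2) hlo hhi k5 k6
  have hUV : |θ 1 - s₁| * W ≤ θ 0 := by
    rw [hδ]; nlinarith [mul_nonneg hd0 hW]
  have hL : α₀ + α₁ * (θ 0 - (s₁ - θ 1) * W) + α₂ * θ 2 + α₃ * (θ 0 - (s₁ - θ 1) * W) * θ 2 ≤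
      energyDensityTT' t s₁ (θ 0 - |θ 1 - s₁| * W) (θ 2) := by
    rw [hδ]; exact hA'
  have hk := energyDensityTT'_ge_of_columnFloor_diagU t s₁ (θ 1) hW hUV hn0 hn2 hL (hF (θ 2) hn0 hn2)
  rw [hδ] at hk
  exact hk

/-- **`t'`-EDGE FLOOR WITH `U`-CONTENT, above the column** (`θ1 ≥ s₁`; e.g. the electron-side image strips beyond the
most positive floored column): under the mirror hypotheses (`s₁ ≤ sa`, `p ≤ Ua − (sb − s₁)W`, `Ub − (sa − s₁)W ≤ q`) the floor
`A(θ0 − (θ1 − s₁)W, θ2) + (θ1 − s₁)(f₀ + f₁θ2) ≤ e(t, θ1, θ0, θ2)`. [cite: Israel1979, Thm. I.3.4] -/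
theorem tc_mlFloor_tEdgeDGU_above (t : ℝ) {s₁ W p q Ua Ub sa sb n₁ n₂ α₀ α₁ α₂ α₃ f₀ f₁ : ℝ}
    (hp : 0 ≤ p) (hW : 0 ≤ W) (hsa : s₁ ≤ sa) (hn₁ : 0 < n₁) (hn₂ : n₂ < 2)
    (hpa : p ≤ Ua - (sb - s₁) * W) (hqb : Ub - (sa - s₁) * W ≤ q)
    (hA : ∀ U n : ℝ, p ≤ U → U ≤ q → n₁ ≤ n → n ≤ n₂ →
      α₀ + α₁ * U + α₂ * n + α₃ * U * n ≤ energyDensityTT' t s₁ U n)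
    (hF : ∀ m : ℝ, 0 < m → m < 2 → f₀ + f₁ * m ≤ energyDensityTT' 1 0 W m) :
    ∀ θ ∈ Set.Icc (![Ua, sa, n₁] : Fin 3 → ℝ) ![Ub, sb, n₂],
      α₀ + α₁ * (θ 0 - (θ 1 - s₁) * W) + α₂ * θ 2 + α₃ * (θ 0 - (θ 1 - s₁) * W) * θ 2 +
          (θ 1 - s₁) * (f₀ + f₁ * θ 2) ≤ energyDensityTT' t (θ 1) (θ 0) (θ 2) := by
  intro θ hθ
  obtain ⟨⟨k1, k2⟩, ⟨k3, k4⟩, ⟨k5, k6⟩⟩ := mem_Icc_vec3_iff.1 hθ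
  have hn0 : 0 < θ 2 := lt_of_lt_of_le hn₁ k5
  have hn2 : θ 2 < 2 := lt_of_le_of_lt k6 hn₂
  have hδ : |θ 1 - s₁| = θ 1 - s₁ := abs_of_nonneg (by linarith)
  have hd0 : 0 ≤ θ 1 - s₁ := by linarith
  have hlo : p ≤ θ 0 - (θ 1 - s₁) * W := by
    have h1 : (θ 1 - s₁) * W ≤ (sb - s₁) * W := mul_le_mul_of_nonneg_right (by linarith) hW
    linarith
  have hhi : θ 0 - (θ 1 - s₁) * W ≤ q := by
    have h1 : (sa - s₁) * W ≤ (θ 1 - s₁) * W := mul_le_mul_of_nonneg_right (by linarith) hW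
    linarith
  have hA' := hA (θ 0 - (θ 1 - s₁) * W) (θ 2) hlo hhi k5 k6
  have hUV : |θ 1 - s₁| * W ≤ θ 0 := by
    rw [hδ]; nlinarith [mul_nonneg hd0 hW]
  have hL : α₀ + α₁ * (θ 0 - (θ 1 - s₁) * W) + α₂ * θ 2 + α₃ * (θ 0 - (θ 1 - s₁) * W) * θ 2 ≤
      energyDensityTT' t s₁ (θ 0 - |θ 1 - s₁| * W) (θ 2) := by
    rw [hδ]; exact hA'
  have hk := energyDensityTT'_ge_of_columnFloor_diagU t s₁ (θ 1) hW hUV hn0 hn2 hL (hF (θ 2) hn0 hn2)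
  rw [hδ] at hk
  exact hk

end Summit.Ventures.CertifiedManyBodySolver.Certificates
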